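import Summits.Ventures.Crystal3D.Theorems.StickyWulffConstantStackingLiminfLayerChainV4Defs
import Mathlib.MeasureTheory.Constructions.HaarToSphere
import Mathlib.MeasureTheory.Measure.Lebesgue.VolumeOfBalls
import Mathlib.MeasureTheory.Measure.Haar.InnerProductSpace
import HarnessLib

/-!
# Rung R1 of line `LayerChain` v4 (crux `StackingLiminf`, stmt-Ventures-19145): the 3D bump has total
# mass exactly `1/√2`

Cell `crystal3d-full`, venture `Summits/Ventures/Crystal3D`.  Planner rung `rung_integral_bump`
(`HOME/cf-p1/route/lines/LayerChainV4Rungs.lean`, R1 [S]; with R2 the line's cheapest falsifier),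
VERBATIM signature over the landed V4 vocabulary
(`bump K u = bumpConst · K⁻³ · (1 − |u|²/K²)₊³`, `bumpConst = 315/(64 π √2)`):
`∫ bump K = 1/√2` for `K > 0` (= the inverse number density of a unit-bond Barlow stacking).
Proof: transfer to `EuclideanSpace ℝ (Fin 3)` (volume preserving), the radial formula
`integral_fun_norm_addHaar` (`dim = 3`, `|B₁| = 4π/3`), and the radial integral
`∫_0^K y² (1 − y²/K²)³ dy = 16K³/315` by the fundamental theorem of calculus.
WHAT THIS IS NOT: anything about the crux; a calculus identity.
-/

noncomputable section

namespace Summit.Ventures.Crystal3D.Theorems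

open MeasureTheory Set Real intervalIntegral Metric
open Summit.Ventures.Crystal3D.LayerChain (dot3)
open Summit.Ventures.Crystal3D.Cruxes.StackingLiminf.LayerChainV4

/-- The radial integral of the 3D bump profile: `∫_{y>0} y² (1 − y²/K²)₊³ dy = 16 K³/315`. -/
theorem integral_bump_radial (K : ℝ) (hK : 0 < K) :
    ∫ y in Ioi (0 : ℝ), y ^ 2 * max 0 (1 - y ^ 2 / K ^ 2) ^ 3 = 16 * K ^ 3 / 315 := by
  have hK2 : K ^ 2 ≠ 0 := pow_ne_zero 2 hK.ne'
  have hcont : Continuous fun y : ℝ => y ^ 2 * max 0 (1 - y ^ 2 / K ^ 2) ^ 3 := by fun_prop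
  have hmax0 : ∀ y, K ^ 2 ≤ y ^ 2 → max 0 (1 - y ^ 2 / K ^ 2) = 0 := by
    intro y hy
    refine max_eq_left ?_
    rw [sub_nonpos, le_div_iff₀ (by positivity), one_mul]
    exact hy
  have hzero : ∀ y, K ≤ y → y ^ 2 * max 0 (1 - y ^ 2 / K ^ 2) ^ 3 = 0 := by
    intro y hy
    rw [hmax0 y (pow_le_pow_left₀ hK.le hy 2), zero_pow three_ne_zero, mul_zero]
  have hsupp : HasCompactSupport fun y : ℝ => y ^ 2 * max 0 (1 - y ^ 2 / K ^ 2) ^ 3 := by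
    refine HasCompactSupport.intro (isCompact_Icc (a := -K) (b := K)) fun y hy => ?_
    rw [mem_Icc, not_and_or, not_le, not_le] at hy
    rcases hy with hy | hy
    · rw [hmax0 y (by nlinarith), zero_pow three_ne_zero, mul_zero]
    · exact hzero y hy.le
  have hint : Integrable fun y : ℝ => y ^ 2 * max 0 (1 - y ^ 2 / K ^ 2) ^ 3 :=
    hcont.integrable_of_hasCompactSupport hsupp
  rw [← Ioc_union_Ioi_eq_Ioi hK.le, setIntegral_union (Set.Ioc_disjoint_Ioi le_rfl)
    measurableSet_Ioi hint.integrableOn hint.integrableOn,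
    setIntegral_eq_zero_of_forall_eq_zero (t := Ioi K) fun y hy => hzero y (le_of_lt (mem_Ioi.1 hy)),
    add_zero, ← integral_of_le hK.le]
  have heq : EqOn (fun y : ℝ => y ^ 2 * max 0 (1 - y ^ 2 / K ^ 2) ^ 3)
      (fun y => y ^ 2 * (1 - y ^ 2 / K ^ 2) ^ 3) (uIcc 0 K) := by
    intro y hy
    rw [uIcc_of_le hK.le, mem_Icc] at hy
    have : 0 ≤ 1 - y ^ 2 / K ^ 2 := by
      rw [sub_nonneg, div_le_one (by positivity)]
      exact pow_le_pow_left₀ hy.1 hy.2 2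
    simp only
    rw [max_eq_right this]
  have hG : ∀ y : ℝ, HasDerivAt (fun s : ℝ => s ^ 3 / 3 - 3 / (5 * K ^ 2) * s ^ 5 +
      3 / (7 * K ^ 4) * s ^ 7 - 1 / (9 * K ^ 6) * s ^ 9) (y ^ 2 * (1 - y ^ 2 / K ^ 2) ^ 3) y := by
    intro y
    have h := ((((hasDerivAt_pow 3 y).div_const 3).sub
      ((hasDerivAt_pow 5 y).const_mul (3 / (5 * K ^ 2)))).add
      ((hasDerivAt_pow 7 y).const_mul (3 / (7 * K ^ 4)))).sub
      ((hasDerivAt_pow 9 y).const_mul (1 / (9 * K ^ 6)))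
    refine h.congr_deriv ?_
    norm_num
    field_simp
    ring
  rw [integral_congr heq, integral_eq_sub_of_hasDerivAt (fun y _ => hG y)
    (by apply Continuous.intervalIntegrable; fun_prop)]
  field_simp
  ring

/-- The bump read on `EuclideanSpace ℝ (Fin 3)` is a radial function. -/
theorem bump_ofLp_eq (K : ℝ) (x : EuclideanSpace ℝ (Fin 3)) :
    bump K (WithLp.ofLp x) = bumpConst / K ^ 3 * max 0 (1 - ‖x‖ ^ 2 / K ^ 2) ^ 3 := by
  unfold bump
  congr 3
  rw [EuclideanSpace.real_norm_sq_eq, Fin.sum_univ_three]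
  unfold dot3
  simp [sq]

/-- **R1 — the 3D bump has total mass exactly `1/√2`**. -/
theorem rung_integral_bump (K : ℝ) (hK : 0 < K) : ∫ u, bump K u = 1 / Real.sqrt 2 := by
  -- transfer to Euclidean space (volume preserving)
  rw [← (EuclideanSpace.volume_preserving_symm_measurableEquiv_toLp (Fin 3)).integral_comp'
    (bump K)]
  simp only [MeasurableEquiv.coe_toLp_symm, bump_ofLp_eq]
  -- radial formula
  have hrad := integral_fun_norm_addHaar (volume : Measure (EuclideanSpace ℝ (Fin 3)))
    (fun y : ℝ => bumpConst / K ^ 3 * max 0 (1 - y ^ 2 / K ^ 2) ^ 3)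
  rw [hrad, finrank_euclideanSpace_fin]
  have hball : (volume : Measure (EuclideanSpace ℝ (Fin 3))).real (ball 0 1) = Real.pi * 4 / 3 := by
    rw [measureReal_def, EuclideanSpace.volume_ball_fin_three, ENNReal.toReal_mul,
      ← ENNReal.ofReal_pow zero_le_one, one_pow, ENNReal.toReal_ofReal zero_le_one,
      ENNReal.toReal_ofReal (by positivity), one_mul]
  rw [hball]
  -- the radial integral
  have hint : ∫ y in Ioi (0 : ℝ), y ^ (3 - 1) • (bumpConst / K ^ 3 * max 0 (1 - y ^ 2 / K ^ 2) ^ 3) =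
      bumpConst / K ^ 3 * (16 * K ^ 3 / 315) := by
    rw [← integral_bump_radial K hK, ← MeasureTheory.integral_const_mul]
    refine setIntegral_congr_fun measurableSet_Ioi fun y _ => ?_
    simp only [smul_eq_mul]
    norm_num
    ring
  rw [hint, nsmul_eq_mul, smul_eq_mul]
  unfold bumpConst
  have hK3 : K ^ 3 ≠ 0 := pow_ne_zero 3 hK.ne'
  have hs : Real.sqrt 2 ≠ 0 := (Real.sqrt_pos.2 (by norm_num)).ne'
  field_simp
  ring

end Summit.Ventures.Crystal3D.Theorems

end
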